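import Summits.AtomisticToContinuum.FouriersLaw.Theorems.BondHeatUncertaintySubdiffusiveBondHeatJunctionRatioFirstBondBracketProof

/-!
# `JunctionRatioSmoothResponse` — file 25a of the junction-ratio programme: the response density is
# (a multiple of the momentum flip of) a SMOOTH POISSON SOLUTION

Route `BondHeatUncertainty`, residual `BoundedResponse` (stmt-AtomisticToContinuum-11071), door
`boundedResponse_of_bracket_of_peeled_of_escapeInfZero_of_subOhmicBootstrap'` (file 21f), leaf **[RR]**
`EscapeGrading.ResponseRegularity` (file 19a, "support · known · fixed N").  [RR] asks, at every `N ≥ 3`, for a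
response density `h` (`IsResponseDensityAt`) which moreover has TAP SCORES at the two contact sites — square
integrable weak momentum derivatives `∂_{p_0} h`, `∂_{p_{N-1}} h ∈ L²(μ_T)` (`IsTapScoreAt`) — and for depth-two
moment coefficients.  The tree's response density (item 9144; `exists_weightedResponseDensity`, 24b) is only
known to be in `L²(μ_T)`.  This file makes it REGULAR: by the construction inside the tree proof of item 9144
(`pinnedChain_exists_responseDensity_of_dual`) the density is `(γ/2T²) · w∘Θ`, `w = ∫₀^∞ P_s g ds` the forward
integral of the odd moment `g = p_0² − p_{N−1}²`, `Θ` the momentum flip; and `w` is — by the Poisson equation in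
`𝓓'` for forward integrals (`integral_transpose_mul_forwardIntegral`), Hörmander's theorem PROVED in the tree
(`exists_smooth_ae_eq_of_weak_poisson`) and `generator_eq_of_weak_poisson`, exactly as for the Kubo corrector
(`Corrector.corrector_smooth`) — Lebesgue-a.e. equal to a SMOOTH classical solution `v` of `L_{T,T} v = −g` with
`|v| ≤ K e^{ϑH}`.

* `oddMoment_poisson_smooth` — the smooth Poisson solution `v` (`w = v` a.e., `L v = −g`, `|v| ≤ K e^{ϑH}`);
* `smoothResponse_repr` — the Green–Kubo functional of the tree's linear response equals `∫ φ · (γ/2T²) v∘Θ dμ_T`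
  (Steps 1–3 of `pinnedChain_exists_responseDensity_of_dual`, ending with the a.e. identification);
* `exists_smoothResponseDensity` — **the weighted linear response with a smooth density**: there are `ϑ > 0`
  (`2ϑ < 1/T`) and a smooth `v` with `L_{T,T} v = −(p_0² − p_{N−1}²)`, `|v| ≤ K e^{ϑH}`, such that for every
  `φ ∈ C²` with `|φ| ≤ C e^{ϑH}` and every steady family `μ`:
  `δ⁻¹(∫ φ dμ_{T+δ/2,T−δ/2} − ∫ φ dμ_T) → ∫ φ · (γ/2T²) v∘Θ dμ_T` (`δ → 0`, `δ ≠ 0`).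

File 25b turns this into `ResponseRegularity`.  No definitions; all theorems fully proved; standard axioms.
References: Cuneo–Eckmann–Hairer–Rey-Bellet 2018 (Thm 2.13, §3.1); Hörmander 1967 (Thm 1.1); folklore.
-/

noncomputable section

open MeasureTheory ProbabilityTheory Filter Topology Set
open scoped NNReal ENNReal ContDiff

namespace Summit.AtomisticToContinuum.FouriersLaw.Theorems.SubdiffusiveBondHeat.EscapeGrading

open Literature.MathematicalPhysics.KineticTheory.HeatConduction
open Literature.Probability.Process Literature.MathematicalPhysics.KineticTheory Literature.Analysis.Distribution
open OscillatorChain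
open Summit.AtomisticToContinuum.FouriersLaw.Theorems.SuperadditiveResistance.PlainForwardField
open Summit.AtomisticToContinuum.FouriersLaw.Theorems.SubdiffusiveBondHeat.JunctionDefectGrading

variable {N : ℕ}

/-! ## A. The smooth Poisson solution for the odd moment `g = p_0² − p_{N−1}²` -/

/-- **The forward integral of the odd moment is smooth and solves the Poisson equation.**  For the pinned chain
at equilibrium temperature `T` (`N ≥ 1`, all parameters `> 0`) and `0 < ϑ`, `2ϑ < 1/T`: there is a smooth `v` with
`∫_{(0,∞)} P_s(p_0² − p_{N−1}²) ds = v` Lebesgue-a.e., `L_{T,T} v = −(p_0² − p_{N−1}²)` pointwise and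
`|v| ≤ K e^{ϑH}`.  (The proof is that of `Corrector.corrector_smooth` with the total current replaced by the odd
moment; inputs `abs_oddMoment_le_exp`, `exists_oddMoment_forecast_decay`.)
[cite: CuneoEckmannHairerReyBellet2018, Thm 2.13] [cite: Hormander1967, Thm 1.1] -/
theorem oddMoment_poisson_smooth {ω₂ lam β γ : ℝ} (hω : 0 < ω₂) (hl : 0 < lam) (hβ : 0 < β) (hγ : 0 < γ)
    {T : ℝ} (hT : 0 < T) (hN : 0 < N) {ϑ : ℝ} (hϑ : 0 < ϑ) (h2ϑ : 2 * ϑ < 1 / T) :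
    ∃ v : PhaseSpace N → ℝ, ContDiff ℝ ∞ v ∧
      (fun x => ∫ s in Ioi (0 : ℝ), ∫ y, (y.2 ⟨0, hN⟩ ^ 2 - y.2 ⟨N - 1, by omega⟩ ^ 2)
        ∂((pinnedChain ω₂ lam β γ).transitionKernel N T T s.toNNReal x)) =ᵐ[volume] v ∧
      (∀ x, (pinnedChain ω₂ lam β γ).generator N T T v x = -(x.2 ⟨0, hN⟩ ^ 2 - x.2 ⟨N - 1, by omega⟩ ^ 2)) ∧
      ∃ K : ℝ, 0 ≤ K ∧ ∀ x, |v x| ≤ K * Real.exp (ϑ * (pinnedChain ω₂ lam β γ).hamiltonian N x) := by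
  haveI := isAddHaarMeasure_volume_phaseSpace N
  set P := pinnedChain ω₂ lam β γ with hP
  have hU : ContDiff ℝ ∞ P.U := pinnedChain_contDiff_U ω₂ lam β γ
  have hV : ContDiff ℝ ∞ P.V := pinnedChain_contDiff_V ω₂ lam β γ
  have hγ' : P.γ = γ := rfl
  have hγT : 0 ≤ P.γ * T := by rw [hγ']; positivity
  set g : PhaseSpace N → ℝ := fun y => y.2 ⟨0, hN⟩ ^ 2 - y.2 ⟨N - 1, by omega⟩ ^ 2 with hg
  have hgs : ContDiff ℝ ∞ g := by rw [hg]; fun_prop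
  have hgc : Continuous g := hgs.continuous
  set Hm := P.hamiltonian N with hHm
  have hHc : Continuous Hm := pinnedChain_continuous_hamiltonian ω₂ lam β γ N
  -- kernels: the chain pipeline's `transitionKernel` is the model-free `langevinKernel`
  have hker : ∀ t, P.langevinKernel N T T t = P.transitionKernel N T T t :=
    fun t => pinnedChain_langevinKernel_eq_transitionKernel N T T hω hl.le hβ.le hγ.le t
  have hϑ1 : ϑ < 1 / T := by linarith
  -- the data: growth of the source and decay of its forecast
  have hgb : ∀ y, |g y| ≤ 4 / ϑ * Real.exp (ϑ * Hm y) := abs_oddMoment_le_exp hω hl.le hβ hN hϑ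
  obtain ⟨C, c, hC, hc, hdec⟩ := exists_oddMoment_forecast_decay hω hl.le hβ hγ hN hT hϑ h2ϑ
  have hdecay' : ∀ (t : ℝ≥0) (z : PhaseSpace N), |∫ y, g y ∂(P.langevinKernel N T T t z)| ≤
      C * Real.exp (ϑ * Hm z) * Real.exp (-c * t) := fun t z => by
    rw [hker]; exact hdec z t
  -- the candidate and its a-priori bound
  set g₀ : PhaseSpace N → ℝ := fun x => ∫ t in Ioi (0 : ℝ),
    ∫ y, g y ∂(P.langevinKernel N T T t.toNNReal x) with hg₀
  have hg₀m : StronglyMeasurable g₀ := stronglyMeasurable_forwardIntegral hω hl.le hβ.le hγ.le hgc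
  set K : ℝ := C * ∫ t in Ioi (0 : ℝ), Real.exp (-c * t) with hK
  have hIpos : 0 ≤ ∫ t in Ioi (0 : ℝ), Real.exp (-c * t) :=
    setIntegral_nonneg measurableSet_Ioi fun t _ => (Real.exp_pos _).le
  have hK0 : 0 ≤ K := by positivity
  have hg₀b : ∀ x, |g₀ x| ≤ K * Real.exp (ϑ * Hm x) := fun x => abs_forwardIntegral_le g hc hdecay' x
  set B : PhaseSpace N → ℝ := fun x => K * Real.exp (ϑ * Hm x) with hB
  have hBc : Continuous B := by rw [hB]; fun_prop
  have hg₀B : ∀ x, ‖g₀ x‖ ≤ ‖B x‖ := fun x => by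
    rw [Real.norm_eq_abs, Real.norm_eq_abs]
    exact (hg₀b x).trans (le_abs_self _)
  have hg₀loc : LocallyIntegrable g₀ volume :=
    hBc.locallyIntegrable.mono hg₀m.aestronglyMeasurable (Eventually.of_forall hg₀B)
  -- the Poisson equation in `𝓓'`
  have hweak₀ : ∀ φ : PhaseSpace N → ℝ, ContDiff ℝ ∞ φ → HasCompactSupport φ →
      ∫ x, g₀ x * hormanderTranspose (P.drift N) (P.bathField hN T T) (fun _ => 0) φ x =
        ∫ x, (-g x) * φ x := by
    intro φ hφ hφc
    have h := integral_transpose_mul_forwardIntegral hω hl.le hβ.le hγ.le hN hT hϑ hϑ1 hc hgs hgb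
      hdecay' hφ hφc
    calc ∫ x, g₀ x * hormanderTranspose (P.drift N) (P.bathField hN T T) (fun _ => 0) φ x
        = ∫ x, (sdeGenerator (fun y => -P.drift N y) (P.bathVecL N T) (P.bathVecR N T) φ x +
            2 * γ * φ x) * g₀ x := by
          refine integral_congr_ae (ae_of_all _ fun x => ?_)
          dsimp only
          rw [hormanderTranspose_generatorFamily_eq_revGenerator P hU hV hN hγT hγT hφ x, hγ', mul_comm]
      _ = -∫ x, φ x * g x := h
      _ = ∫ x, (-g x) * φ x := by
          rw [← integral_neg]
          exact integral_congr_ae (ae_of_all _ fun x => by ring)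
  -- hypoelliptic regularity and the classical equation
  obtain ⟨v, hv, hae⟩ := exists_smooth_ae_eq_of_weak_poisson hβ.le hγ hN hT hg₀loc hgs.neg hweak₀
  have hweak : ∀ φ : PhaseSpace N → ℝ, ContDiff ℝ ∞ φ → HasCompactSupport φ →
      ∫ x, v x * hormanderTranspose (P.drift N) (P.bathField hN T T) (fun _ => 0) φ x =
        ∫ x, (-g x) * φ x := by
    intro φ hφ hφc
    rw [← hweak₀ φ hφ hφc]
    refine integral_congr_ae ?_
    filter_upwards [hae] with x hx
    rw [hx]
  have hclass : ∀ x, P.generator N T T v x = -g x :=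
    generator_eq_of_weak_poisson P hU hV hN hγT hγT hv hgc.neg hweak
  have hg₀' : (fun x => ∫ t in Ioi (0 : ℝ), ∫ y, g y ∂(P.transitionKernel N T T t.toNNReal x)) = g₀ := by
    funext x; simp only [hg₀, hker]
  refine ⟨v, hv, by rw [hg₀']; exact hae, hclass, K, hK0, fun x => ?_⟩
  have hael : ∀ᵐ y ∂(volume : Measure (PhaseSpace N)), |v y| ≤ K * Real.exp (ϑ * Hm y) := by
    filter_upwards [hae] with y hy
    rw [← hy]; exact hg₀b y
  exact OddSectorIrreversibility.Corrector.le_of_ae_le_of_continuous (continuous_abs.comp hv.continuous)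
    (by fun_prop) hael x

/-! ## B. The Green–Kubo functional of the linear response, represented by the smooth density -/

/-- **Representation of the response functional by the smooth density.**  With `v` as in
`oddMoment_poisson_smooth` (only `w = v` Lebesgue-a.e. is used), for every `φ ∈ C²` with
`|φ| ≤ C e^{ϑH}`:
`(γ/2T²) Z⁻¹ ∫₀^∞ ∫ P_s φ · e^{-H/T}(p_0² − p_{N−1}²) dx ds = ∫ φ · (γ/2T²) v∘Θ dμ_T`
(detailed balance `pinnedChain_hDUAL`, the momentum flip, Fubini — Steps 1–3 of
`pinnedChain_exists_responseDensity_of_dual` — and `w∘Θ = v∘Θ` a.e., `Θ` preserving Lebesgue measure).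
[re-assembly of tree theorems] -/
theorem smoothResponse_repr {ω₂ lam β γ : ℝ} (hω : 0 < ω₂) (hl : 0 < lam) (hβ : 0 < β) (hγ : 0 < γ)
    {T : ℝ} (hT : 0 < T) (hN : 0 < N) {ϑ : ℝ} (hϑ : 0 < ϑ) (h2ϑ : 2 * ϑ < 1 / T)
    {v : PhaseSpace N → ℝ}
    (hae : (fun x => ∫ s in Ioi (0 : ℝ), ∫ y, (y.2 ⟨0, hN⟩ ^ 2 - y.2 ⟨N - 1, by omega⟩ ^ 2)
        ∂((pinnedChain ω₂ lam β γ).transitionKernel N T T s.toNNReal x)) =ᵐ[volume] v)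
    (φ : PhaseSpace N → ℝ) (C : ℝ) (hφ2 : ContDiff ℝ 2 φ)
    (hφ : ∀ y, |φ y| ≤ C * Real.exp (ϑ * (pinnedChain ω₂ lam β γ).hamiltonian N y)) :
    (γ / (2 * T ^ 2)) / (∫ x, Real.exp (-1 / T * (pinnedChain ω₂ lam β γ).hamiltonian N x)) *
        ∫ s in Ioi (0 : ℝ), ∫ x, (∫ y, φ y ∂((pinnedChain ω₂ lam β γ).transitionKernel N T T
            s.toNNReal x)) *
          (Real.exp (-1 / T * (pinnedChain ω₂ lam β γ).hamiltonian N x) *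
            (x.2 ⟨0, hN⟩ ^ 2 - x.2 ⟨N - 1, by omega⟩ ^ 2)) =
      ∫ x, φ x * ((γ / (2 * T ^ 2)) * v (x.1, -x.2)) ∂((pinnedChain ω₂ lam β γ).gibbsMeasure N T) := by
  have hHc : Continuous ((pinnedChain ω₂ lam β γ).hamiltonian N) :=
    (pinnedChain_contDiff_hamiltonian ω₂ lam β γ N (n := 0)).continuous
  have hθ2ϑ : -1 / T + 2 * ϑ < 0 := by
    have : -1 / T + 2 * ϑ = 2 * ϑ - 1 / T := by ring
    rw [this]; linarith
  have hgc : Continuous fun y : PhaseSpace N => y.2 ⟨0, hN⟩ ^ 2 - y.2 ⟨N - 1, by omega⟩ ^ 2 := by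
    fun_prop
  obtain ⟨Cg, c, hCg, hc, hdec⟩ := exists_oddMoment_forecast_decay hω hl.le hβ hγ hN hT hϑ h2ϑ
  have hDUAL := pinnedChain_hDUAL hω hl.le hβ.le hγ hN hT hϑ h2ϑ
  -- the inner forecast `(s, z) ↦ P_s g(z)` and its measurability
  have hmeasK := pinnedChain_measurable_integral_kernel_uncurry hω hl.le hβ.le hγ.le N T T
    hgc.stronglyMeasurable (φ := fun y : PhaseSpace N => y.2 ⟨0, hN⟩ ^ 2 - y.2 ⟨N - 1, by omega⟩ ^ 2)
  have hΘm : Measurable fun x : PhaseSpace N => ((x.1, -x.2) : PhaseSpace N) :=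
    measurable_fst.prodMk measurable_snd.neg
  have hmap : Measurable fun p : PhaseSpace N × ℝ =>
      ((p.2.toNNReal, ((p.1.1, -p.1.2) : PhaseSpace N)) : ℝ≥0 × PhaseSpace N) :=
    (measurable_real_toNNReal.comp measurable_snd).prodMk (hΘm.comp measurable_fst)
  have hFm : Measurable fun p : PhaseSpace N × ℝ => ∫ y, (y.2 ⟨0, hN⟩ ^ 2 - y.2 ⟨N - 1, by omega⟩ ^ 2)
      ∂((pinnedChain ω₂ lam β γ).transitionKernel N T T p.2.toNNReal (p.1.1, -p.1.2)) :=
    (hmeasK.comp hmap :)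
  have hφc : Continuous φ := hφ2.continuous
  have hC : 0 ≤ C := by
    have := (abs_nonneg _).trans (hφ 0)
    exact nonneg_of_mul_nonneg_left this (Real.exp_pos _)
  have hg4 : ∀ y : PhaseSpace N, |y.2 ⟨0, hN⟩ ^ 2 - y.2 ⟨N - 1, by omega⟩ ^ 2| ≤
      4 / ϑ * Real.exp (ϑ * (pinnedChain ω₂ lam β γ).hamiltonian N y) :=
    abs_oddMoment_le_exp hω hl.le hβ hN hϑ
  -- Step 1: detailed balance and the momentum reversal, at each time `s`
  have hstep1 : ∀ s : ℝ, ∫ x, (∫ y, φ y ∂((pinnedChain ω₂ lam β γ).transitionKernel N T T s.toNNReal x)) *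
      (Real.exp (-1 / T * (pinnedChain ω₂ lam β γ).hamiltonian N x) *
        (x.2 ⟨0, hN⟩ ^ 2 - x.2 ⟨N - 1, by omega⟩ ^ 2)) =
      ∫ x, Real.exp (-1 / T * (pinnedChain ω₂ lam β γ).hamiltonian N x) * φ x *
        ∫ y, (y.2 ⟨0, hN⟩ ^ 2 - y.2 ⟨N - 1, by omega⟩ ^ 2)
          ∂((pinnedChain ω₂ lam β γ).transitionKernel N T T s.toNNReal (x.1, -x.2)) := by
    intro s
    have hg2 : ContDiff ℝ 2 fun y : PhaseSpace N => y.2 ⟨0, hN⟩ ^ 2 - y.2 ⟨N - 1, by omega⟩ ^ 2 := by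
      fun_prop
    have hd := hDUAL s.toNNReal φ (fun y => y.2 ⟨0, hN⟩ ^ 2 - y.2 ⟨N - 1, by omega⟩ ^ 2) C (4 / ϑ) hφ2
      hg2 hφ hg4
    simp only [Pi.neg_apply, neg_sq] at hd
    calc _ = ∫ x, Real.exp (-1 / T * (pinnedChain ω₂ lam β γ).hamiltonian N x) *
          (x.2 ⟨0, hN⟩ ^ 2 - x.2 ⟨N - 1, by omega⟩ ^ 2) *
          ∫ y, φ y ∂((pinnedChain ω₂ lam β γ).transitionKernel N T T s.toNNReal x) :=
          integral_congr_ae (Eventually.of_forall fun x => by simp only; ring)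
      _ = ∫ x, Real.exp (-1 / T * (pinnedChain ω₂ lam β γ).hamiltonian N x) * φ (x.1, -x.2) *
          ∫ y, (y.2 ⟨0, hN⟩ ^ 2 - y.2 ⟨N - 1, by omega⟩ ^ 2)
            ∂((pinnedChain ω₂ lam β γ).transitionKernel N T T s.toNNReal x) := hd
      _ = _ := by
          rw [← integral_comp_momentumReversal N (fun x =>
            Real.exp (-1 / T * (pinnedChain ω₂ lam β γ).hamiltonian N x) *
            φ (x.1, -x.2) * ∫ y, (y.2 ⟨0, hN⟩ ^ 2 - y.2 ⟨N - 1, by omega⟩ ^ 2)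
              ∂((pinnedChain ω₂ lam β γ).transitionKernel N T T s.toNNReal x))]
          refine integral_congr_ae (Eventually.of_forall fun x => ?_)
          simp only [neg_neg, Prod.mk.eta, (pinnedChain ω₂ lam β γ).hamiltonian_neg_momentum N x]
  simp_rw [hstep1]
  -- Step 2: Fubini
  have hI2 := integrable_exp_mul_hamiltonian hω hl.le hβ.le γ (N := N) hθ2ϑ
  have hprod : Integrable (Function.uncurry fun (s : ℝ) (x : PhaseSpace N) =>
      Real.exp (-1 / T * (pinnedChain ω₂ lam β γ).hamiltonian N x) * φ x *
        ∫ y, (y.2 ⟨0, hN⟩ ^ 2 - y.2 ⟨N - 1, by omega⟩ ^ 2)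
          ∂((pinnedChain ω₂ lam β γ).transitionKernel N T T s.toNNReal (x.1, -x.2)))
      ((volume.restrict (Ioi (0:ℝ))).prod volume) := by
    have hm : Measurable (Function.uncurry fun (s : ℝ) (x : PhaseSpace N) =>
        Real.exp (-1 / T * (pinnedChain ω₂ lam β γ).hamiltonian N x) * φ x *
          ∫ y, (y.2 ⟨0, hN⟩ ^ 2 - y.2 ⟨N - 1, by omega⟩ ^ 2)
            ∂((pinnedChain ω₂ lam β γ).transitionKernel N T T s.toNNReal (x.1, -x.2))) :=
      ((((Real.continuous_exp.comp (continuous_const.mul hHc)).mul hφc).measurable.comp measurable_snd).mul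
        (hFm.comp measurable_swap) :)
    refine (((exp_neg_integrableOn_Ioi 0 hc).const_mul (C * Cg)).mul_prod hI2).mono' hm.aestronglyMeasurable
      (Eventually.of_forall fun p => ?_)
    rcases p with ⟨s, x⟩
    have hHΘ : (pinnedChain ω₂ lam β γ).hamiltonian N (x.1, -x.2) =
        (pinnedChain ω₂ lam β γ).hamiltonian N x := (pinnedChain ω₂ lam β γ).hamiltonian_neg_momentum N x
    have hK := hdec (x.1, -x.2) s.toNNReal
    rw [hHΘ] at hK
    have hs : Real.exp (-c * (s.toNNReal : ℝ)) ≤ Real.exp (-c * s) :=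
      Real.exp_le_exp.2 (by nlinarith [Real.le_coe_toNNReal s, hc])
    simp only [Function.uncurry_apply_pair]
    rw [Real.norm_eq_abs, abs_mul, abs_mul, abs_of_pos (Real.exp_pos _),
      show (-1 / T + 2 * ϑ) * (pinnedChain ω₂ lam β γ).hamiltonian N x =
        -1 / T * (pinnedChain ω₂ lam β γ).hamiltonian N x +
          ϑ * (pinnedChain ω₂ lam β γ).hamiltonian N x + ϑ * (pinnedChain ω₂ lam β γ).hamiltonian N x by ring,
      Real.exp_add, Real.exp_add]
    have hE1 := (Real.exp_pos (-1 / T * (pinnedChain ω₂ lam β γ).hamiltonian N x)).le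
    have hE2 := (Real.exp_pos (ϑ * (pinnedChain ω₂ lam β γ).hamiltonian N x)).le
    calc Real.exp (-1 / T * (pinnedChain ω₂ lam β γ).hamiltonian N x) * |φ x| *
          |∫ y, (y.2 ⟨0, hN⟩ ^ 2 - y.2 ⟨N - 1, by omega⟩ ^ 2)
            ∂((pinnedChain ω₂ lam β γ).transitionKernel N T T s.toNNReal (x.1, -x.2))|
        ≤ Real.exp (-1 / T * (pinnedChain ω₂ lam β γ).hamiltonian N x) *
            (C * Real.exp (ϑ * (pinnedChain ω₂ lam β γ).hamiltonian N x)) *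
          (Cg * Real.exp (ϑ * (pinnedChain ω₂ lam β γ).hamiltonian N x) * Real.exp (-c * s)) := by
          refine mul_le_mul (mul_le_mul_of_nonneg_left (hφ x) hE1) (hK.trans ?_) (abs_nonneg _)
            (by positivity)
          exact mul_le_mul_of_nonneg_left hs (by positivity)
      _ = _ := by ring
  rw [integral_integral_swap hprod]
  -- Step 3: the Gibbs normalisation and the a.e. identification `w∘Θ = v∘Θ`
  simp_rw [integral_const_mul]
  rw [(pinnedChain ω₂ lam β γ).integral_gibbsMeasure]
  have hρ : ∀ x : PhaseSpace N, (pinnedChain ω₂ lam β γ).gibbsDensity N T x =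
      Real.exp (-1 / T * (pinnedChain ω₂ lam β γ).hamiltonian N x) := fun x => by
    simp only [OscillatorChain.gibbsDensity]; congr 1; ring
  simp_rw [hρ]
  rw [div_eq_mul_inv, mul_comm (γ / (2 * T ^ 2)), mul_assoc, ← integral_const_mul]
  congr 1
  have haeΘ := (measurePreserving_momentumReversal N).quasiMeasurePreserving.ae_eq_comp hae
  refine integral_congr_ae ?_
  filter_upwards [haeΘ] with x hx
  simp only [Function.comp_apply, momentumReversal_apply] at hx
  rw [hx]
  ring

/-! ## C. The weighted linear response with the smooth density -/

/-- **(WR-smooth) Linear response on the weighted `C²` class, with a SMOOTH density.**  For the pinned chain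
(all parameters `> 0`), `T > 0`, `N ≥ 1`: there are `ϑ > 0` with `2ϑ < 1/T` and a smooth `v` with
`L_{T,T} v = −(p_0² − p_{N−1}²)` and `|v| ≤ K e^{ϑH}` such that, with `h := (γ/2T²) v∘Θ`, for every `φ ∈ C²` with
`|φ| ≤ C e^{ϑH}` and every family `μ` of weak steady states:
`δ⁻¹ (∫ φ dμ_{T+δ/2,T-δ/2} - ∫ φ dμ_T) → ∫ φ h dμ_T` as `δ → 0`, `δ ≠ 0`
(`exists_weightedResponseDensity` of 24b with `pinnedChain_exists_responseDensity_of_dual` replaced by §A–§B).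
[re-assembly of tree theorems] -/
theorem exists_smoothResponseDensity {ω₂ lam β γ : ℝ} (hω : 0 < ω₂) (hl : 0 < lam) (hβ : 0 < β)
    (hγ : 0 < γ) {T : ℝ} (hT : 0 < T) (hN : 0 < N) :
    ∃ ϑ : ℝ, 0 < ϑ ∧ 2 * ϑ < 1 / T ∧ ∃ v : PhaseSpace N → ℝ, ContDiff ℝ ∞ v ∧
      (∀ x, (pinnedChain ω₂ lam β γ).generator N T T v x = -(x.2 ⟨0, hN⟩ ^ 2 - x.2 ⟨N - 1, by omega⟩ ^ 2)) ∧
      (∃ K : ℝ, 0 ≤ K ∧ ∀ x, |v x| ≤ K * Real.exp (ϑ * (pinnedChain ω₂ lam β γ).hamiltonian N x)) ∧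
      ∀ (φ : PhaseSpace N → ℝ) (C : ℝ), ContDiff ℝ 2 φ →
        (∀ y, |φ y| ≤ C * Real.exp (ϑ * (pinnedChain ω₂ lam β γ).hamiltonian N y)) →
        ∀ μ : ℝ → ℝ → Measure (PhaseSpace N),
          (∀ T_L T_R : ℝ, 0 < T_L → 0 < T_R →
            (pinnedChain ω₂ lam β γ).IsSteadyState N T_L T_R (μ T_L T_R)) →
          Tendsto (fun δ : ℝ => ((∫ x, φ x ∂(μ (T + δ / 2) (T - δ / 2))) -
              ∫ x, φ x ∂((pinnedChain ω₂ lam β γ).gibbsMeasure N T)) / δ)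
            (𝓝[≠] 0) (𝓝 (∫ x, φ x * ((γ / (2 * T ^ 2)) * v (x.1, -x.2))
              ∂((pinnedChain ω₂ lam β γ).gibbsMeasure N T))) := by
  have huniq := bondHeatUncertainty_nessUnique_holds ω₂ lam β γ hω hl hβ hγ
  obtain ⟨δ₀, ϑ, Cm, c, hδ₀, hδ₀T, hϑ, hϑT, h2ϑ, hCm, hc, hUM⟩ :=
    OddSectorIrreversibility.Corrector.pinnedChain_uniformMixing hω hl.le hβ hγ hN hT
  obtain ⟨v, hv, hae, hLv, hK⟩ := oddMoment_poisson_smooth hω hl hβ hγ hT hN hϑ h2ϑ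
  refine ⟨ϑ, hϑ, h2ϑ, v, hv, hLv, hK, fun φ C hφ2 hφ μ hμ => ?_⟩
  have hident := fun (T_L T_R : ℝ) (hL : 0 < T_L) (hR : 0 < T_R) =>
    steadyFamily_isInvariant hω hl.le hβ hγ hN (huniq N) μ hμ hL hR
  have hTT : μ T T = (pinnedChain ω₂ lam β γ).gibbsMeasure N T :=
    huniq N T T hT hT _ _ (hμ T T hT hT) (pinnedChain_isSteadyState_gibbsMeasure hω hl.le hβ.le γ N hT)
  have hμP : ∀ δ : ℝ, |δ| < δ₀ → IsProbabilityMeasure (μ (T + δ / 2) (T - δ / 2)) := fun δ hδ =>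
    (hident _ _ (bath_facts_of_abs_lt hδ₀T hϑT hδ).1 (bath_facts_of_abs_lt hδ₀T hϑT hδ).2.1).1
  have hμI : ∀ δ : ℝ, |δ| < δ₀ → ∀ t : ℝ≥0, (μ (T + δ / 2) (T - δ / 2)).bind
      ((pinnedChain ω₂ lam β γ).transitionKernel N (T + δ / 2) (T - δ / 2) t) =
      μ (T + δ / 2) (T - δ / 2) := fun δ hδ =>
    (hident _ _ (bath_facts_of_abs_lt hδ₀T hϑT hδ).1 (bath_facts_of_abs_lt hδ₀T hϑT hδ).2.1).2
  have hlr := pinnedChain_linear_response_of_uniformMixing hω hl.le hβ hγ hN hT hδ₀ hδ₀T hϑ hϑT hφ2 hφ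
    hCm hc hUM (pinnedChain_tendsto_integral_kernel_temps hω hl.le hβ.le hγ hN hT hϑ h2ϑ hφ2.continuous hφ)
    (fun δ => μ (T + δ / 2) (T - δ / 2)) hμP hμI
  rw [smoothResponse_repr hω hl hβ hγ hT hN hϑ h2ϑ hae φ C hφ2 hφ] at hlr
  simp only [zero_div, add_zero, sub_zero] at hlr
  rw [hTT] at hlr
  exact hlr

end Summit.AtomisticToContinuum.FouriersLaw.Theorems.SubdiffusiveBondHeat.EscapeGrading

end
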